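import Summits.CriticalPhenomena.SAWScalingLimit.Theses.SAWTwistedSelfEnergy
import Summits.CriticalPhenomena.SAWScalingLimit.Theorems.SAWRenewalTightnessEventualTightOfVirginArc
import Summits.CriticalPhenomena.SAWScalingLimit.Theorems.SAWRenewalTightnessEventualTightFiniteExterior
import Summits.CriticalPhenomena.SAWScalingLimit.Theorems.EventualTight.Negative.StrengtheningsFalse
import Summits.CriticalPhenomena.SAWScalingLimit.Theorems.EventualTight.Negative.EndpointLimitsFalse
import Summits.CriticalPhenomena.SAWScalingLimit.Theorems.EventualTight.Negative.TightnessNecessary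
import HarnessLib

/-!
# Line `leaves` — skeleton for the crux `SAWTwistedSelfEnergy.EventualTight` (stmt-CriticalPhenomena-1881), the two research leaves

Crux-strategist registration (seat `planner-cstrat-stmt-CriticalPhenomena-1881-b1-0`, bet route
`SAWTwistedSelfEnergy`, 2026-08-17; ALT to `Lines/birth.lean`).  The crux

  `SAWTwistedSelfEnergy.EventualTight :
     ∀ D a b, SAW.IsEndpointApprox D a b → IsTightAlongMesh (fun δ γ ↦ γ.curve) (fun δ ↦ SAW.law D.carrier δ (a δ) (b δ))`

is the rank-7 precompactness binder of the bet route's deciding theorem `closes`; the route's own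
mechanism (spin-5/8 twisted self-energy of the ℤ² SAW) feeds the observable target and the
identification binder, not this one (census: `Cruxes/EventualTight/STRATEGY-CENSUS.md`, bet-route
section).  The item is shared by fifteen routes and Lean-equivalent to the set-form twin stmt-1372,
whose line `Sketch` (registration v8, lead c5/c6) is COMPOSITION-COMPLETE modulo two research leaves,
both first-class items.  This line is that end state, concluded at the bet route's decl BY NAME, so that
(i) a lead seated on stmt-1881 for ANY along-the-mesh route starts from the landed rungs instead of
rebuilding `birth`'s clean-shadow virginization (strategist S-EC Rec. 3, `MERGE-c3.md` §2), and (ii) one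
proof of either leaf is matched against this crux's registered stubs as well.

The TWO registered stubs (verbatim the family's live leaves; nothing else is open):

* `stub_confinementPositivity` — E = restriction positivity, byte-identical to item
  stmt-CriticalPhenomena-17587 `ConfinementPositivity` (child of stmt-1372 on `SAWRenewalTightness`
  and of stmt-1881 on `SAWExcursionCardy`; own line lead + disprover + ideation cell; summit-implied by
  `Theorems.confinementPositivity_of_scalingLimit`, p105757): a LOWER bound.  Size: open-problem.
* `stub_virginArcTraversalTightFinite` — X2c₁ᶠ = the bulk atom in its FINITE-EXTERIOR form,
  byte-identical to the registered open stub of stmt-1372's line `Sketch` v8: Kemppainen–Smirnov-type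
  traversal tightness of the critical `x_c`-ARC measure of a VIRGIN lattice disc at one annulus shape
  `D(z₀; 2N/5, 3N/5)`, uniform over FINITE allowed sets `Λ` outside the disc and over the two doors (an
  UPPER bound on a multi-strand event; pure lattice, mesh-free, finitely many arcs, both masses finite
  sums).  Equivalent to X2c₁ = item stmt-CriticalPhenomena-17940 `VirginArcTraversalTight` by the landed
  rung F `Theorems.virginArcTraversalTight_of_finite` (p146587; converse = specialisation).  Size:
  open-problem (the ONE statement of the family not implied by the conjunct: uniform over exteriors).

Composition (no `sorry` of its own): `EventualTight_of hE hXf :=` bridge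
`isTightAlongMesh_of_isTightMeasureSet_image` ∘ landed
`Theorems.eventualTight_of_virginArcTraversalTight_of_confinementPositivity (virginArcTraversalTight_of_finite hXf) hE`
(virginization V4 p141866/p141673/p141996/p141593, aspect reduction p143627, split glue p142166,
Aizenman–Burchard criterion `TightOfShellCrossing_proof`, all in tree).

Disproof used (`Cruxes/EventualTight/Disproof.lean`, cdisprove gen 1, unchanged since 2026-08-16T05:37Z; no
`-- Targets` section): `eventualTight_false_without_endpointLimits` — the endpoint limits are spent inside
V4 (`bulkShellTightAtAspectTwo_of_virginArcTraversalTight`: the lattice endpoints leave every interior cut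
disc eventually) and in E's `IsEndpointApprox D'`; `not_uniformThreshold` / `not_uniformDomains`
(`Negative/StrengtheningsFalse`, imported) — every threshold of the landed chain is per `(D, a, b)`, per
shell, eventual in `δ`; neither stub swaps a quantifier over domains, meshes or approximations (X2c₁ᶠ has no
domain at all; E is per nested pair and per approximation); §5 dyadic snake (Jordan loop load-bearing) —
enters only through E's socketed enlargement (`stub_socketedEnlargement`, p97679, under the landed split).
`Negative/TightnessNecessary` (imported): ¬crux ⇒ ¬summit, so no stub is attacked from the negative side
here.  No stub is an instance of a landed Negative lemma (checked by importing the three files above).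
-/

noncomputable section

open MeasureTheory Filter Topology Set Metric
open scoped ENNReal NNReal unitInterval
open Literature.Probability.RandomPlanarGeometry Literature.Probability.LatticeModels

namespace Summit.CriticalPhenomena.SAWScalingLimit.Cruxes.EventualTight.Leaves

/-! ## The two registered stubs -/

/-- **Stub E — restriction positivity** (byte-identical to item stmt-CriticalPhenomena-17587
`ConfinementPositivity`; verbatim `stub_confinementPositivity` of stmt-1372's line `Sketch` v5–v8): for
nested Dobrushin domains `D' ⊆ D` with the same marked points and sockets
`D ∩ (B(a,d) ∪ B(b,d)) ⊆ D'`, and every endpoint approximation of `D'`, the critical SAW of `D_δ` from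
`a_δ` to `b_δ` is a `D'_δ`-walk with probability `≥ c > 0` for all `δ ∈ (0, δ₀]`.  A LOWER bound (the
SAW box-crossing property); equivalent to `liminf_δ Z_{D'}/Z_D > 0`
(`Theorems.confinementPositivity_iff_partitionRatio`), implied by the conjunct
(`Theorems.confinementPositivity_of_scalingLimit`, p105757), monotone in nested quadruples
(`Theorems.confinementRatio_mono`).  Why plausibly true: it is a consequence of `SAWScalingLimit` (SLE₈⸝₃
tube positivity); numerics `Z_{D'}/Z_D ≈ 0.6–0.7` flat in `δ` (PERM j012789).  Open-problem sized: an
RSW-type lower bound for the `x_c`-SAW is proved on no lattice. -/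
theorem stub_confinementPositivity :
    ∀ (D D' : DobrushinDomain) (a b : ℝ → Site 2) (d : ℝ), 0 < d →
      D'.carrier ⊆ D.carrier → D'.pt 0 = D.pt 0 → D'.pt 1 = D.pt 1 →
      D.carrier ∩ (Metric.ball (D.pt 0) d ∪ Metric.ball (D.pt 1) d) ⊆ D'.carrier →
      SAW.IsEndpointApprox D' a b →
        ∃ c δ₀ : ℝ, 0 < c ∧ 0 < δ₀ ∧ ∀ δ ∈ Set.Ioc (0 : ℝ) δ₀,
          ENNReal.ofReal c ≤ SAW.law D.carrier δ (a δ) (b δ)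
            {γ | ∃ γ' : SAW.DomainSAW D'.carrier δ (a δ) (b δ),
              γ'.walk.support = γ.walk.support} := by
  sorry

/-- **Stub X2c₁ᶠ — the bulk atom, finite-exterior form** (byte-identical to the registered open stub
`stub_virginArcTraversalTightFinite` of stmt-1372's line `Sketch` v8; equivalent by the landed rung F to
item stmt-CriticalPhenomena-17940 `VirginArcTraversalTight`): for every `θ > 0` there are `k, N₀` such
that for every configuration `(H, Λ)` VIRGIN in the closed lattice disc `B̄(z₀, N)`, `N ≥ N₀` (`H ≤ ℤ²`,
every lattice point of the disc allowed, every lattice edge of `B̄(z₀, N+1)` an `H`-edge, NOTHING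
assumed outside) with `Λ` FINITE, and every two doors `(u,c)`, `(u',c')` on the rim, the `x_c`-mass of
self-avoiding `H`-arcs `c → c'` in `Λ` whose vertex sequence makes `k` weak traversals of
`D(z₀; 2N/5, 3N/5)` is `≤ θ ·` (mass of all arcs).  An UPPER bound on a multi-strand event, uniform over
exteriors and doors — NOT implied by the crux or the conjunct (a forcing exterior could refute it while
`BulkShellTight` survives).  Why plausibly true: 65 exterior configurations (rooms, bays, corridors,
perforated walls, whole plane, two punctures; j022738) show no forcing; the structural adversary census
`LeadAnalysis-c5.md` §1 (exteriors act only through an optional non-crossing rim matching and a bounded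
rim potential, neither coupling to the depth of inside chords).  Open-problem sized: KS Condition G2 for
the critical ℤ² SAW arc has no tool (no FKG/BK/RSW/observable on ℤ²). -/
theorem stub_virginArcTraversalTightFinite :
    ∀ θ : ℝ, 0 < θ →
      ∃ (k : ℕ) (N₀ : ℝ), 0 < N₀ ∧
        ∀ (H : SimpleGraph (Site 2)) (Λ : Set (Site 2)) (z₀ : ℂ) (N : ℝ) (u c u' c' : Site 2),
          Λ.Finite → N₀ ≤ N →
          (H ≤ zdGraph 2 ∧ (∀ v : Site 2, dist (Site.toComplex v) z₀ ≤ N → v ∈ Λ) ∧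
            ∀ v v' : Site 2, dist (Site.toComplex v) z₀ ≤ N + 1 →
              dist (Site.toComplex v') z₀ ≤ N + 1 → (zdGraph 2).Adj v v' → H.Adj v v') →
          (H.Adj u c ∧ u ∉ Λ ∧ c ∈ Λ ∧ dist (Site.toComplex c) z₀ ≤ N ∧
            N < dist (Site.toComplex u) z₀) →
          (H.Adj u' c' ∧ u' ∉ Λ ∧ c' ∈ Λ ∧ dist (Site.toComplex c') z₀ ≤ N ∧
            N < dist (Site.toComplex u') z₀) →
          ∑' p : {p : {p : H.Walk c c' // p.IsPath ∧ ∀ v ∈ p.support, v ∈ Λ} //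
              ∃ ι κ : Fin k → Fin (p.1.support.map Site.toComplex).length, (∀ m, ι m ≤ κ m) ∧
                (∀ m, (dist ((p.1.support.map Site.toComplex).get (ι m)) z₀ ≤ 2 * N / 5 ∧
                    3 * N / 5 ≤ dist ((p.1.support.map Site.toComplex).get (κ m)) z₀) ∨
                  (3 * N / 5 ≤ dist ((p.1.support.map Site.toComplex).get (ι m)) z₀ ∧
                    dist ((p.1.support.map Site.toComplex).get (κ m)) z₀ ≤ 2 * N / 5)) ∧
                ∀ ⦃m m'⦄, m < m' → κ m ≤ ι m'},
              ENNReal.ofReal (SAW.criticalFugacity ^ p.1.1.length) ≤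
            ENNReal.ofReal θ *
              ∑' p : {p : H.Walk c c' // p.IsPath ∧ ∀ v ∈ p.support, v ∈ Λ},
                ENNReal.ofReal (SAW.criticalFugacity ^ p.1.length) := by
  sorry

/-! ## The skeleton theorem: the stubs imply the crux, BY NAME -/

/-- **`SAWTwistedSelfEnergy.EventualTight` from the two leaves** (kernel-checked, no `sorry` of its own):
the finite-exterior atom gives X2c₁ by exhaustion (rung F, `Theorems.virginArcTraversalTight_of_finite`),
X2c₁ and E give the set-form twin stmt-1372 by the landed chain
(`Theorems.eventualTight_of_virginArcTraversalTight_of_confinementPositivity`: two-sided domain-Markov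
virginization V4, aspect reduction, restriction-positivity transfer to every shell in the Aizenman–Burchard
dress, `TightOfShellCrossing_proof`), and the Literature bridge
`isTightAlongMesh_of_isTightMeasureSet_image` (the SAW curve observable is measurable at every mesh) the
along-the-mesh crux. [cite: AizenmanBurchardDuke1999, Thms 1.1-1.2; KemppainenSmirnov2017, Thm 1.5] -/
theorem EventualTight_of
    (hE : ∀ (D D' : DobrushinDomain) (a b : ℝ → Site 2) (d : ℝ), 0 < d →
      D'.carrier ⊆ D.carrier → D'.pt 0 = D.pt 0 → D'.pt 1 = D.pt 1 →
      D.carrier ∩ (Metric.ball (D.pt 0) d ∪ Metric.ball (D.pt 1) d) ⊆ D'.carrier →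
      SAW.IsEndpointApprox D' a b →
        ∃ c δ₀ : ℝ, 0 < c ∧ 0 < δ₀ ∧ ∀ δ ∈ Set.Ioc (0 : ℝ) δ₀,
          ENNReal.ofReal c ≤ SAW.law D.carrier δ (a δ) (b δ)
            {γ | ∃ γ' : SAW.DomainSAW D'.carrier δ (a δ) (b δ),
              γ'.walk.support = γ.walk.support})
    (hXf : ∀ θ : ℝ, 0 < θ →
      ∃ (k : ℕ) (N₀ : ℝ), 0 < N₀ ∧
        ∀ (H : SimpleGraph (Site 2)) (Λ : Set (Site 2)) (z₀ : ℂ) (N : ℝ) (u c u' c' : Site 2),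
          Λ.Finite → N₀ ≤ N →
          (H ≤ zdGraph 2 ∧ (∀ v : Site 2, dist (Site.toComplex v) z₀ ≤ N → v ∈ Λ) ∧
            ∀ v v' : Site 2, dist (Site.toComplex v) z₀ ≤ N + 1 →
              dist (Site.toComplex v') z₀ ≤ N + 1 → (zdGraph 2).Adj v v' → H.Adj v v') →
          (H.Adj u c ∧ u ∉ Λ ∧ c ∈ Λ ∧ dist (Site.toComplex c) z₀ ≤ N ∧
            N < dist (Site.toComplex u) z₀) →
          (H.Adj u' c' ∧ u' ∉ Λ ∧ c' ∈ Λ ∧ dist (Site.toComplex c') z₀ ≤ N ∧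
            N < dist (Site.toComplex u') z₀) →
          ∑' p : {p : {p : H.Walk c c' // p.IsPath ∧ ∀ v ∈ p.support, v ∈ Λ} //
              ∃ ι κ : Fin k → Fin (p.1.support.map Site.toComplex).length, (∀ m, ι m ≤ κ m) ∧
                (∀ m, (dist ((p.1.support.map Site.toComplex).get (ι m)) z₀ ≤ 2 * N / 5 ∧
                    3 * N / 5 ≤ dist ((p.1.support.map Site.toComplex).get (κ m)) z₀) ∨
                  (3 * N / 5 ≤ dist ((p.1.support.map Site.toComplex).get (ι m)) z₀ ∧
                    dist ((p.1.support.map Site.toComplex).get (κ m)) z₀ ≤ 2 * N / 5)) ∧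
                ∀ ⦃m m'⦄, m < m' → κ m ≤ ι m'},
              ENNReal.ofReal (SAW.criticalFugacity ^ p.1.1.length) ≤
            ENNReal.ofReal θ *
              ∑' p : {p : H.Walk c c' // p.IsPath ∧ ∀ v ∈ p.support, v ∈ Λ},
                ENNReal.ofReal (SAW.criticalFugacity ^ p.1.length)) :
    Summit.CriticalPhenomena.SAWScalingLimit.Theses.SAWTwistedSelfEnergy.EventualTight := by
  intro D a b hab
  obtain ⟨δ₀, hδ₀, hT⟩ :=
    Theorems.eventualTight_of_virginArcTraversalTight_of_confinementPositivity
      (Theorems.virginArcTraversalTight_of_finite hXf) hE D a b hab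
  exact isTightAlongMesh_of_isTightMeasureSet_image
    (Eventually.of_forall fun δ => SAW.aemeasurable_curve D.carrier δ (a δ) (b δ)) hδ₀ hT

/-- **The crux proof modulo the stubs** (wiring check: the registered stubs feed the skeleton theorem as
stated; becomes the crux proof when the two `sorry`s above are discharged). -/
theorem EventualTight_proof :
    Summit.CriticalPhenomena.SAWScalingLimit.Theses.SAWTwistedSelfEnergy.EventualTight :=
  EventualTight_of stub_confinementPositivity stub_virginArcTraversalTightFinite

/-! ## Sorry-free remarks -/

/-- ¬crux ⇒ ¬conjunct (landed `Negative/TightnessNecessary`, through the set form and the bridge): the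
line is never attacked from the negative side. -/
theorem not_summit_of_not_crux
    (h : ¬ Summit.CriticalPhenomena.SAWScalingLimit.Theses.SAWTwistedSelfEnergy.EventualTight) :
    ¬ SAW.SAWScalingLimit := by
  refine Theorems.EventualTight.Negative.not_sawScalingLimit_of_not_eventualTight fun hset => h ?_
  intro D a b hab
  obtain ⟨δ₀, hδ₀, hT⟩ := hset D a b hab
  exact isTightAlongMesh_of_isTightMeasureSet_image
    (Eventually.of_forall fun δ => SAW.aemeasurable_curve D.carrier δ (a δ) (b δ)) hδ₀ hT

end Summit.CriticalPhenomena.SAWScalingLimit.Cruxes.EventualTight.Leaves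

end
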